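import Summits.BirchSwinnertonDyer.BirchSwinnertonDyer.Theorems.PrintCf2DisegniPairTwoFrameCoreOfModel
import Summits.BirchSwinnertonDyer.BirchSwinnertonDyer.Theorems.PrintCf2DisegniPairTwoRealComponents
import Summits.BirchSwinnertonDyer.BirchSwinnertonDyer.Theorems.PrintCf2DisegniPairTwoFrameH0
import Summits.BirchSwinnertonDyer.BirchSwinnertonDyer.Theorems.PrintCf2DisegniPairTwoFramePair
import Summits.BirchSwinnertonDyer.BirchSwinnertonDyer.Theorems.PrintCf2DisegniPairTwoDisegniGZPairEight
import Summits.BirchSwinnertonDyer.BirchSwinnertonDyer.Theorems.PrintCf2SplitBadParityCrossingPartner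
import Summits.BirchSwinnertonDyer.BirchSwinnertonDyer.Theses.PrintCf2
import Literature.NumberTheory.EllipticCurves.CanonicalPAdicHeightCycExistenceTwoProofs
import Literature.NumberTheory.EllipticCurves.ModularParametrizationBCDTProofs
import Literature.NumberTheory.EllipticCurves.AnalyticRankModularityProofs
import Literature.NumberTheory.EllipticCurves.BertrandCMHeightNonvanishingMinusTwist
import Literature.NumberTheory.EllipticCurves.Cm7QuadraticTwistGoodAtTwo
import Literature.FieldTheory.AlgClosed.PadicAlgClEquivComplex
import HarnessLib

/-!
# Road (C) `disegni-pair-two` on crux stmt-BirchSwinnertonDyer-20368 — TIGHTNESS of the line: the (Δ1) descent law FOLLOWS from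
# `BSD(W,2)` on the `7`-free members (modulo the line's prints), so (Δ1) ⟺ the crux's `7`-free conclusion modulo prints

Cell `bsd-print-cf2`, LEAD `bsd-line-cf2-p1` g26 (`--supports stmt-BirchSwinnertonDyer-20368`, helper). THEOREMS ONLY (no `def`, no named
fact introduced, no `sorry`); conditional on every displayed hypothesis. BSD is not proved by any of this; no summit statement is claimed;
20368 is NOT closed here; (Δ1) is NOT asserted here — it is DERIVED from the Birch–Swinnerton-Dyer `2`-part of the members.

The registered skeleton `Cruxes/SplitBadTwoRankOneOfFacts/Lines/disegni_pair_two.lean` (v3.10) closes the crux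
`PrintCf2.SplitBadTwoRankOneOfFacts` from 12 primary prints (S0′, S0″) and ONE research stub, the `2`-adic leading-term law
(Δ1) `stub_law_descent_two` (LEAD g25's law socket `splitBadTwoRankOneOfFacts_of_printStubs_of_lawDescent_two`). This file proves the
CONVERSE direction in the kernel:

* ★★ `lawDescent_two_of_bsdp_sevenFree` — granted four S0′ prints (Disegni Thm A+B at `ψ∘N`, Bertrand at `2`, Friedberg–Hoffstein, the
  parametrisation datum), GZ86 I.(7.3) and GZK: if `BSD(W,2)` (Miller's `BSDp W 2`) holds for every `7`-free member `W` of the split-bad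
  class (`C • W = 49a1^{(d)}`, `d` squarefree, `d ≢ 1 (4)`, `7 ∤ d`, `r_an(W) = 1`), then the text of (Δ1) holds VERBATIM, with the class
  function `e_D(class) = ρ(class) − 2` (`ρ` = the universal pin offsets of the eight-prints ticket). MECHANISM: the (Δ1) text quantifies
  over ARBITRARY admissible data — any globally minimal model `V` of the good partner, any `f` with `IsNewformOf V f`, any period ratio
  `ϖ`/`μ`, any generator `P`, any canonical minus-twist datum `Dc` — and the line's machines accept exactly such data: the frame is run AT
  THE GIVEN MODEL (`frame_core_fixing_of_model`, file `…FrameCoreOfModel.lean`), the eight-prints ticket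
  `disegniGZ_pair_two_of_eight_prints` and the key theorems `defectKey_chi8_modulo_descent_min` /
  `defectKey_chi4_modulo_descent_min_of_Δ_neg` / `defectKey_chi8'_modulo_descent_min_of_Δ_neg` are universally quantified over
  `(V, f, P, Dc, DH, …)`, Bertrand gives `h₂ ≠ 0`; the key identity `v₂(q) + v₂(Tam) + v₂(h₂) = v₂(D) + 2 + 2v₂(#tors) + v₂(ϖ|μ)` with
  `h₂ = r·⟨P,P⟩_{Dc}`, `v₂(r) = ρ`, and `BSD(W,2)`: `v₂(q) = v₂ #Ш(W)[2^∞]` (`q = #Ш_an(W)`) give the law by `linarith`. No transport of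
  `2`-adic `L`-functions, periods or heights between models is needed.
* ★ `lawDescent_two_of_splitBadTwoRankOneOfFacts` — the same from THE CRUX ITSELF: `𝔅_split → PrintCf2.SplitBadTwoRankOneOfFacts → (Δ1)`
  granted the four S0′ prints and GZ86 I.(7.3) (a member `C • W = 49a1^{(d)}` has CM with `2` split and is bad at `2`:
  `hasCM_and_cmSplit_two_of_smul_eq_cm7_quadraticTwist`, `not_good_two_of_smul_eq_cm7_quadraticTwist`).

CONSEQUENCE (the LEAD's tightness certificate for the line): together with the law socket, (Δ1) ⟺ «`BSD(W,2)` for every `7`-free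
split-bad member of analytic rank one» modulo the 12 named prints and `𝔅_split`; in particular (Δ1) is implied by the Birch–Swinnerton-Dyer
conjecture (modulo those prints) — the research stub is NOT a strengthening of the crux and cannot fail for reasons the crux survives.

References: D. Disegni, Compos. Math. 153 (2017) Thm. B [Disegni2017]; B. Gross, D. Zagier, Invent. Math. 84 (1986) Thm. I.(7.3)
[GrossZagier1986]; B. Mazur, J. Tate, J. Teitelbaum, Invent. Math. 84 (1986) §I.14 [MazurTateTeitelbaum1986Invent]; D. Bertrand, LNM 1068
(1984) §3 Cor. 1 [Bertrand1984ThetaCM]; R. L. Miller, LMS J. Comput. Math. 14 (2011) Def. 1.1 [Miller2011LMS].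
-/

set_option autoImplicit false
set_option linter.dupNamespace false

noncomputable section

open scoped Classical MatrixGroups ModularForm NumberField NumberTheorySymbols

open CongruenceSubgroup NumberField IsDedekindDomain Field WeierstrassCurve WeierstrassCurve.Affine.Point
  Literature.NumberTheory Literature.NumberTheory.EllipticCurves Literature.NumberTheory.EllipticCurves.ModularForms
  Literature.NumberTheory.EllipticCurves.Disegni2017 Literature.NumberTheory.GaloisRepresentations
  Literature.NumberTheory.EllipticCurves.CaiShuTian2014 Literature.NumberTheory.EllipticCurves.CoatesLiTianZhai2015
  Literature.NumberTheory.EllipticCurves.Rank1Residual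
  Summit.BirchSwinnertonDyer.Rank1Residual.AdditivePotMult
  Summit.BirchSwinnertonDyer.BirchSwinnertonDyer.Theses.PrintCf2
  Summit.BirchSwinnertonDyer.BirchSwinnertonDyer.Theorems
  Summit.BirchSwinnertonDyer.BirchSwinnertonDyer.Theorems.GoldfeldGoodTwists

namespace Summit.BirchSwinnertonDyer.BirchSwinnertonDyer.Theorems.PrintCf2.DisegniPairTwo

/-! ### §0 Arithmetic of the class parameters -/

/-- `2d′` is squarefree for `d′ ≡ 1 (mod 4)` squarefree. [folklore] -/
private theorem squarefree_two_mul_of_emod_four {d' : ℤ} (hd4 : d' % 4 = 1) (hsq : Squarefree d') :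
    Squarefree (2 * d') := by
  rw [← Int.squarefree_natAbs, Int.natAbs_mul, show (2 : ℤ).natAbs = 2 from rfl,
    Nat.squarefree_mul (Nat.coprime_two_left.mpr (Int.natAbs_odd.mpr (Int.odd_iff.mpr (by omega))))]
  exact ⟨Nat.squarefree_two, Int.squarefree_natAbs.mpr hsq⟩

/-- The member's model as a model of `49a1^{(d* d′)}`: `C • W = V^{(d*)}`, `C₁ • V = 49a1^{(d′)}` ⟹
`(⟨u(C₁), d*·r(C₁), 0, 0⟩ C) • W = 49a1^{(d* d′)}` (twisting commutes with isomorphisms, `(E^{(a)})^{(b)} = E^{(ab)}`).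
[cite: SilvermanAEC2009, X.2 Prop. 2.4 and X.5 Cor. 5.4.1] -/
private theorem member_smul_eq_cm7_quadraticTwist {d' : ℤ} {V W : WeierstrassCurve ℚ} {C₁ C : VariableChange ℚ}
    (hC₁ : C₁ • V = cm7.quadraticTwist (d' : ℚ)) (ds : ℤ) (hC : C • W = V.quadraticTwist (ds : ℚ)) :
    ((⟨C₁.u, (ds : ℚ) * C₁.r, 0, 0⟩ : VariableChange ℚ) * C) • W = cm7.quadraticTwist (((ds * d' : ℤ)) : ℚ) := by
  rw [mul_smul, hC, ← quadraticTwist_smul, hC₁, quadraticTwist_quadraticTwist,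
    show (d' : ℚ) * (ds : ℚ) = (((ds * d' : ℤ)) : ℚ) by push_cast; ring]

/-! ### §1 (Δ1) from `BSD(W,2)` on the `7`-free members -/

set_option maxHeartbeats 800000 in
/-- ★★ **TIGHTNESS: the (Δ1) descent law from `BSD(W,2)` on the `7`-free split-bad members, modulo four S0′ prints, GZ86 I.(7.3) and
GZK.** The conclusion is the registered stub text `stub_law_descent_two` (v3.5–v3.10) VERBATIM; the class function is
`e_D(a,b) = (if a = 1 then ρ₄ else if b % 4 = 1 then ρ₈ else ρ₈′) − 2` with `ρ` the eight-prints ticket's universal pin offsets. Proof, per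
class: frame AT THE GIVEN MODEL (`frame_core_fixing_of_model`) ⟶ branch-point vanishing `h0` ⟶ sigma-squared pair of `V ⊗ ℚ₂` ⟶ THE canonical
cyclotomic `H`-datum (`exists_isCanonicalCyc_two_of_pair`) ⟶ Disegni's pinned datum at the GIVEN `(f, Dc, P)` (eight-prints ticket) ⟶ Bertrand
(`⟨P,P⟩ ≠ 0`) ⟶ key theorem ⟶ `BSD(W,2)` for the member `(⟨u(C₁), d*·r(C₁), 0, 0⟩ C) • W = 49a1^{(d* d′)}` ⟶ `linarith`.
[cite: Disegni2017, Thm B (arXiv v3 PDF p. 8)] [cite: GrossZagier1986, Thm I.(7.3)] [cite: Bertrand1984ThetaCM, §3 Cor. 1]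
[cite: MazurTateTeitelbaum1986Invent, §I.14] [cite: Miller2011LMS, Def. 1.1] -/
theorem lawDescent_two_of_bsdp_sevenFree
    (hThmB : Disegni2017.thmB_chi_quadraticBaseChange)
    (hB : bertrand_pairingSqMinusTwist_self_ne_zero_two)
    (hFH : friedbergHoffstein_exists_heegnerField_split_twist_ne_zero)
    (hnp : ModularForms.nonempty_modularParametrizationData)
    (hGZ73 : GrossZagier1986_thm_I_7_3) (hrank : rank_eq_analyticRank_of_analyticRank_le_one)
    -- `BSD(W,2)` on the `7`-free split-bad members of analytic rank one (the crux's conclusion, in the socket's `d`-currency)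
    (hbsd : ∀ (d : ℤ), d ≠ 0 → Squarefree d → ¬ (7 : ℤ) ∣ d → d % 4 ≠ 1 →
      ∀ (W : WeierstrassCurve ℚ) [W.IsElliptic] [W.IsGloballyMinimal] (C : VariableChange ℚ),
        C • W = cm7.quadraticTwist (d : ℚ) → W.analyticRank = 1 → BSDp W 2) :
    ∃ e_D : ℤ → ℤ → ℤ,
    -- the `χ₈∘N`-class: `d = 2d′`, `D = Σ_k k·[T^k]L₂(f,α)·(−2)^{k−1}`, plus period ratio `ϖ`
    (∀ (d' : ℤ), d' % 4 = 1 → Squarefree d' → ¬ (7 : ℤ) ∣ d' →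
      ∀ (V : WeierstrassCurve ℚ) [V.IsElliptic] [V.IsGloballyMinimal] (C₁ : VariableChange ℚ),
        C₁ • V = cm7.quadraticTwist (d' : ℚ) →
      ∀ {N : ℕ} [NeZero N] (f : CuspForm (Gamma0 N) 2), IsNewformOf V f →
      ∀ (ϖ : ℚ), ϖ ≠ 0 → (ϖ : ℝ) * V.realPeriodRat = plusPeriod f →
      ∀ (W : WeierstrassCurve ℚ) [W.IsElliptic] [W.IsGloballyMinimal] [(V.quadraticTwist 2).IsElliptic]
        (C : VariableChange ℚ), C • W = V.quadraticTwist 2 → W.analyticRank = 1 →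
      ∀ (P : (V.quadraticTwist 2).toAffine.Point), ¬ IsOfFinAddOrder P →
        (∀ R : (V.quadraticTwist 2).toAffine.Point,
          ∃ (k : ℤ) (T : (V.quadraticTwist 2).toAffine.Point), IsOfFinAddOrder T ∧ R = k • P + T) →
      ∀ (Dc : PAdicHeightData (V.quadraticTwist 2) 2), Dc.IsCanonicalSqMinusTwist →
        (∑' k : ℕ, PowerSeries.coeff k (padicLFunction f (unitRoot V 2 : ℚ_[2])) * (k : ℚ_[2]) *
            (-2) ^ (k - 1)).valuation + padicValRat 2 ϖ - (Dc.pairing P P).valuation =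
          (padicValNat 2 (Nat.card (AddCommGroup.primaryComponent W.sha 2)) : ℤ) +
            (padicValNat 2 W.tamagawaProduct : ℤ) - 2 * (padicValNat 2 W.torsionOrder : ℤ) + e_D 0 (d' % 8)) ∧
    -- the `χ₋₄∘N`-class: `d = −d′`, `D = [T¹]L₂⁻(f,α)` (derivative at `T = 0` of the minus branch), `μ`
    (∀ (d' : ℤ), d' % 4 = 1 → Squarefree d' → ¬ (7 : ℤ) ∣ d' →
      ∀ (V : WeierstrassCurve ℚ) [V.IsElliptic] [V.IsGloballyMinimal] (C₁ : VariableChange ℚ),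
        C₁ • V = cm7.quadraticTwist (d' : ℚ) →
      ∀ {N : ℕ} [NeZero N] (f : CuspForm (Gamma0 N) 2), IsNewformOf V f →
      ∀ (μ : ℚ), μ ≠ 0 → (μ : ℝ) * V.imaginaryPeriodRat = minusPeriod f →
      ∀ (W : WeierstrassCurve ℚ) [W.IsElliptic] [W.IsGloballyMinimal] [(V.quadraticTwist (-1)).IsElliptic]
        (C : VariableChange ℚ), C • W = V.quadraticTwist (-1) → W.analyticRank = 1 →
      ∀ (P : (V.quadraticTwist (-1)).toAffine.Point), ¬ IsOfFinAddOrder P →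
        (∀ R : (V.quadraticTwist (-1)).toAffine.Point,
          ∃ (k : ℤ) (T : (V.quadraticTwist (-1)).toAffine.Point), IsOfFinAddOrder T ∧ R = k • P + T) →
      ∀ (Dc : PAdicHeightData (V.quadraticTwist (-1)) 2), Dc.IsCanonicalSqMinusTwist →
        (PowerSeries.coeff 1 (padicLFunctionMinusBranch f (unitRoot V 2 : ℚ_[2]) 1)).valuation + padicValRat 2 μ - (Dc.pairing P P).valuation =
          (padicValNat 2 (Nat.card (AddCommGroup.primaryComponent W.sha 2)) : ℤ) +
            (padicValNat 2 W.tamagawaProduct : ℤ) - 2 * (padicValNat 2 W.torsionOrder : ℤ) + e_D 1 ((-d') % 8)) ∧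
    -- the `χ₋₈∘N`-class: `d = −2d′`, `D = Σ_k k·[T^k]L₂⁻(f,α)·(−2)^{k−1}`, `μ`
    (∀ (d' : ℤ), d' % 4 = 1 → Squarefree d' → ¬ (7 : ℤ) ∣ d' →
      ∀ (V : WeierstrassCurve ℚ) [V.IsElliptic] [V.IsGloballyMinimal] (C₁ : VariableChange ℚ),
        C₁ • V = cm7.quadraticTwist (d' : ℚ) →
      ∀ {N : ℕ} [NeZero N] (f : CuspForm (Gamma0 N) 2), IsNewformOf V f →
      ∀ (μ : ℚ), μ ≠ 0 → (μ : ℝ) * V.imaginaryPeriodRat = minusPeriod f →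
      ∀ (W : WeierstrassCurve ℚ) [W.IsElliptic] [W.IsGloballyMinimal] [(V.quadraticTwist (-2)).IsElliptic]
        (C : VariableChange ℚ), C • W = V.quadraticTwist (-2) → W.analyticRank = 1 →
      ∀ (P : (V.quadraticTwist (-2)).toAffine.Point), ¬ IsOfFinAddOrder P →
        (∀ R : (V.quadraticTwist (-2)).toAffine.Point,
          ∃ (k : ℤ) (T : (V.quadraticTwist (-2)).toAffine.Point), IsOfFinAddOrder T ∧ R = k • P + T) →
      ∀ (Dc : PAdicHeightData (V.quadraticTwist (-2)) 2), Dc.IsCanonicalSqMinusTwist →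
        (∑' k : ℕ, PowerSeries.coeff k (padicLFunctionMinusBranch f (unitRoot V 2 : ℚ_[2]) 1) * (k : ℚ_[2]) *
            (-2) ^ (k - 1)).valuation + padicValRat 2 μ - (Dc.pairing P P).valuation =
          (padicValNat 2 (Nat.card (AddCommGroup.primaryComponent W.sha 2)) : ℤ) +
            (padicValNat 2 W.tamagawaProduct : ℤ) - 2 * (padicValNat 2 W.torsionOrder : ℤ) + e_D 0 ((-d') % 8)) := by
  -- modularity (newform) and the entire `L`-function are DERIVED from the parametrisation datum (v3.7)
  have hnew : exists_isNewformOf := ModularForms.exists_isNewformOf_of_nonempty_modularParametrizationData hnp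
  have hmod : hasEntireLFunction_rat := WeierstrassCurve.hasEntireLFunction_rat_of_exists_isNewformOf hnew
  obtain ⟨⟨ρ₈, hdis8⟩, ⟨ρ₄, hdis4⟩, ⟨ρ₈', hdis8'⟩⟩ := disegniGZ_pair_two_of_eight_prints hThmB hmod
  obtain ⟨ι⟩ := PadicAlgCl.nonempty_ringEquiv_complex 2
  refine ⟨fun a b => (if a = 1 then ρ₄ else if b % 4 = 1 then ρ₈ else ρ₈') - 2, ?_, ?_, ?_⟩
  · -- the `χ₈∘N`-class: `d* = 2`, member `49a1^{(2d′)}`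
    intro d' hd4 hsq h7 V _ _ C₁ hC₁ N _ f hfV ϖ hϖ0 hϖ W _ _ _ C hC hr P hP hgen Dc hDc
    have hrk : W.mordellWeilRank = 1 := by
      have h := (hrank W (by rw [hr])).1
      rw [h, hr]
    -- the frame AT THE GIVEN MODEL `V`, newform `f`, member model `C`
    have hC' : C • W = V.quadraticTwist (((2 : ℤ)) : ℚ) := by rw [hC]; norm_num
    haveI : (V.quadraticTwist (((2 : ℤ)) : ℚ)).IsElliptic := by rw [Int.cast_ofNat]; infer_instance
    have hrest := frame_core_fixing_of_model hmod hnew hFH hrank (ds := 2) (Or.inl rfl) hd4 hsq V C₁ hC₁ hfV W hC' hr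
    obtain ⟨K, _, _, _, hK, h2, hsplit, 𝔭, 𝔭', h𝔭, h𝔭', h𝔭𝔭', hrest⟩ := hrest
    obtain ⟨κ, hκ, hκ2, hdK, V', _, _, hordV, hordV', hap, hgoodV, hrest⟩ := hrest
    obtain ⟨N', _, f', hfV', hV', hrest⟩ := hrest
    obtain ⟨M, M', _, _, g, g', W', _, hg, hg', hgε, hg'ε, hL', hL0, hrest⟩ := hrest
    obtain ⟨H, _, _, _, _, hKH, t, htK, ht2, G, χ, hrest⟩ := hrest
    obtain ⟨s, hs, hGK, τ, hτG, hsτ, hτK, hτt, u, e, hu, hue, c, hcu, htors⟩ := hrest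
    have hgε' : ∀ m : ℕ, cuspCoeff g m = (ZMod.χ₈.ringHomComp (Int.castRingHom ℂ)) m * cuspCoeff f m := fun m => by
      rw [hgε m, chi8_ringHomComp_natCast]
    have hg'ε' : ∀ m : ℕ, cuspCoeff g' m = (ZMod.χ₈.ringHomComp (Int.castRingHom ℂ)) m * cuspCoeff f' m := fun m => by
      rw [hg'ε m, chi8_ringHomComp_natCast]
    have ht2' : t ^ 2 = algebraMap ℚ H 2 := by exact_mod_cast ht2
    have htors' : ∀ Q : ((V.quadraticTwist 2).quadraticTwist e).toAffine.Point, IsOfFinAddOrder Q := by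
      rw [← Int.cast_ofNat]; exact htors
    have h0 := hasSum_padicLFunction_neg_two_zero_of_member V W hordV hfV hC hr
    have hpair := exists_isMazurTateSigmaSqPair_two_of_smul_eq_cm7_quadraticTwist hd4 hsq V C₁ hC₁
    have hN : ¬ 2 ∣ N := not_two_dvd_level_of_isOrdinaryAt hfV hordV
    have hj : V.j = -3375 := j_eq_of_cm7_quadraticTwist hd4 V C₁ hC₁
    have hgood : V.HasGoodReductionAtPrime 2 := cm7_quadraticTwist_hasGoodReductionAtPrime_two hd4 V C₁ hC₁
    -- Disegni's pinned datum at the given `(f, Dc, P)` (eight-prints ticket), Bertrand, the key theorem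
    obtain ⟨DH, hDH, hGZc, r, hr0, hrv, hpinall⟩ := hdis8 ι K hK hsplit 𝔭 𝔭' h𝔭 h𝔭' h𝔭𝔭' κ hκ V V' hordV hpair f f'
      hfV hfV' hV' g g' W W' hg hg' hgε' hg'ε' hr hL' hKH (exists_isCanonicalCyc_two_of_pair V H hpair) htK ht2'
      (not_mem_range_rat_of_not_mem_range htK) G χ s hs hGK τ hτG hsτ hτK hτt
    have hpin := hpinall Dc hDc P
    have hcan : Dc.pairing P P ≠ 0 :=
      bertrand_pairingSqMinusTwist_self_ne_zero_two.pairing_self_ne_zero hB hj hgood (d := 2) (by norm_num) hDc hP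
    have hr0' : (r : ℚ_[2]) ≠ 0 := by exact_mod_cast hr0
    have hh₂ : (r : ℚ_[2]) * Dc.pairing P P ≠ 0 := mul_ne_zero hr0' hcan
    obtain ⟨-, q, hq, -, hv⟩ := defectKey_chi8_modulo_descent_min ι K hGZ73 h2 hsplit 𝔭 𝔭' h𝔭 h𝔭' κ hκ hκ2 hdK V V'
      hordV hordV' hap hN hfV hfV' hV' h0 hmod W W' hg hg' hgε' hg'ε' hr hrk hL' hKH htK ht2' G χ s hs τ hτG hsτ hτK hτt
      hu hue c hcu hC hgen htors' DH hDH hpin hGZc hϖ0 hϖ hh₂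
    have hval : ((r : ℚ_[2]) * Dc.pairing P P).valuation = ρ₈ + (Dc.pairing P P).valuation := by
      rw [Padic.valuation_mul hr0' hcan, Padic.valuation_ratCast, hrv]
    rw [hval] at hv
    -- `BSD(W,2)` for the member `49a1^{(2d′)}`
    obtain ⟨-, -, q', hq', hv'⟩ := hbsd (2 * d') (by omega) (squarefree_two_mul_of_emod_four hd4 hsq)
      (fun h => h7 (by omega)) (by omega) W _ (member_smul_eq_cm7_quadraticTwist hC₁ 2 hC') hr
    have hqq : q' = q := by
      have h : ((q' : ℚ) : ℂ) = ((q : ℚ) : ℂ) := by rw [← hq', hq]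
      exact_mod_cast h
    rw [hqq] at hv'
    show _ = _ + ((if (0 : ℤ) = 1 then ρ₄ else if d' % 8 % 4 = 1 then ρ₈ else ρ₈') - 2)
    rw [if_neg (by norm_num), if_pos (by omega)]
    linarith
  · -- the `χ₋₄∘N`-class: `d* = −1`, member `49a1^{(−d′)}`
    intro d' hd4 hsq h7 V _ _ C₁ hC₁ N _ f hfV μ hμ0 hμ W _ _ _ C hC hr P hP hgen Dc hDc
    have hrk : W.mordellWeilRank = 1 := by
      have h := (hrank W (by rw [hr])).1
      rw [h, hr]
    have hC' : C • W = V.quadraticTwist (((-1 : ℤ)) : ℚ) := by rw [hC]; norm_num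
    haveI : (V.quadraticTwist (((-1 : ℤ)) : ℚ)).IsElliptic := by rw [Int.cast_neg, Int.cast_one]; infer_instance
    have hrest := frame_core_fixing_of_model hmod hnew hFH hrank (ds := -1) (Or.inr (Or.inl rfl)) hd4 hsq V C₁ hC₁ hfV W
      hC' hr
    obtain ⟨K, _, _, _, hK, h2, hsplit, 𝔭, 𝔭', h𝔭, h𝔭', h𝔭𝔭', hrest⟩ := hrest
    obtain ⟨κ, hκ, hκ2, hdK, V', _, _, hordV, hordV', hap, hgoodV, hrest⟩ := hrest
    obtain ⟨N', _, f', hfV', hV', hrest⟩ := hrest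
    obtain ⟨M, M', _, _, g, g', W', _, hg, hg', hgε, hg'ε, hL', hL0, hrest⟩ := hrest
    obtain ⟨H, _, _, _, _, hKH, t, htK, ht2, G, χ, hrest⟩ := hrest
    obtain ⟨s, hs, hGK, τ, hτG, hsτ, hτK, hτt, u, e, hu, hue, c, hcu, htors⟩ := hrest
    have hgε' : ∀ m : ℕ, cuspCoeff g m = (ZMod.χ₄.ringHomComp (Int.castRingHom ℂ)) m * cuspCoeff f m := fun m => by
      rw [hgε m, chi4_ringHomComp_natCast]
    have hg'ε' : ∀ m : ℕ, cuspCoeff g' m = (ZMod.χ₄.ringHomComp (Int.castRingHom ℂ)) m * cuspCoeff f' m := fun m => by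
      rw [hg'ε m, chi4_ringHomComp_natCast]
    have ht2' : t ^ 2 = algebraMap ℚ H (-1) := by exact_mod_cast ht2
    have htors' : ∀ Q : ((V.quadraticTwist (-1)).quadraticTwist e).toAffine.Point, IsOfFinAddOrder Q := by
      rw [← Int.cast_one, ← Int.cast_neg]; exact htors
    have h0 := constantCoeff_padicLFunctionMinusBranch_zero_of_member hmod V W hordV hfV hg hgε' hL0
    have hpair := exists_isMazurTateSigmaSqPair_two_of_smul_eq_cm7_quadraticTwist hd4 hsq V C₁ hC₁
    have hj : V.j = -3375 := j_eq_of_cm7_quadraticTwist hd4 V C₁ hC₁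
    have hgood : V.HasGoodReductionAtPrime 2 := cm7_quadraticTwist_hasGoodReductionAtPrime_two hd4 V C₁ hC₁
    have hΔ : V.Δ < 0 :=
      Δ_neg_of_smul_eq_quadraticTwist cm7 V (by rw [Δ_cm7]; norm_num) (d := ((d' : ℤ) : ℚ))
        (by exact_mod_cast (show (d' : ℤ) ≠ 0 by omega)) (C := C₁⁻¹) (by rw [← hC₁, inv_smul_smul])
    obtain ⟨DH, hDH, hGZc, r, hr0, hrv, hpinall⟩ := hdis4 ι K hK hsplit 𝔭 𝔭' h𝔭 h𝔭' h𝔭𝔭' κ hκ V V' hordV hpair f f'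
      hfV hfV' hV' g g' W W' hg hg' hgε' hg'ε' hr hL' hKH (exists_isCanonicalCyc_two_of_pair V H hpair) htK ht2'
      (not_mem_range_rat_of_not_mem_range htK) G χ s hs hGK τ hτG hsτ hτK hτt
    have hpin := hpinall Dc hDc P
    have hcan : Dc.pairing P P ≠ 0 :=
      bertrand_pairingSqMinusTwist_self_ne_zero_two.pairing_self_ne_zero hB hj hgood (d := -1) (by norm_num) hDc hP
    have hr0' : (r : ℚ_[2]) ≠ 0 := by exact_mod_cast hr0
    have hh₂ : (r : ℚ_[2]) * Dc.pairing P P ≠ 0 := mul_ne_zero hr0' hcan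
    obtain ⟨-, q, hq, -, hv⟩ := defectKey_chi4_modulo_descent_min_of_Δ_neg ι K hGZ73 h2 hsplit 𝔭 𝔭' h𝔭 h𝔭' κ hκ
      hκ2 hdK V V' hΔ hordV hordV' hap hfV hfV' hV' h0 hmod W W' hg hg' hgε' hg'ε' hr hrk hL' hKH htK ht2' G χ s hs τ
      hτG hsτ hτK hτt hu hue c hcu hC hgen htors' DH hDH hpin hGZc hμ0 hμ hh₂
    have hval : ((r : ℚ_[2]) * Dc.pairing P P).valuation = ρ₄ + (Dc.pairing P P).valuation := by
      rw [Padic.valuation_mul hr0' hcan, Padic.valuation_ratCast, hrv]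
    rw [hval] at hv
    -- `BSD(W,2)` for the member `49a1^{(−d′)}`
    obtain ⟨-, -, q', hq', hv'⟩ := hbsd (-1 * d') (by omega) (Squarefree.squarefree_of_dvd ⟨-1, by ring⟩ hsq)
      (fun h => h7 (by omega)) (by omega) W _ (member_smul_eq_cm7_quadraticTwist hC₁ (-1) hC') hr
    have hqq : q' = q := by
      have h : ((q' : ℚ) : ℂ) = ((q : ℚ) : ℂ) := by rw [← hq', hq]
      exact_mod_cast h
    rw [hqq] at hv'
    show _ = _ + ((if (1 : ℤ) = 1 then ρ₄ else if (-d') % 8 % 4 = 1 then ρ₈ else ρ₈') - 2)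
    rw [if_pos rfl]
    linarith
  · -- the `χ₋₈∘N`-class: `d* = −2`, member `49a1^{(−2d′)}`
    intro d' hd4 hsq h7 V _ _ C₁ hC₁ N _ f hfV μ hμ0 hμ W _ _ _ C hC hr P hP hgen Dc hDc
    have hrk : W.mordellWeilRank = 1 := by
      have h := (hrank W (by rw [hr])).1
      rw [h, hr]
    have hC' : C • W = V.quadraticTwist (((-2 : ℤ)) : ℚ) := by rw [hC]; norm_num
    haveI : (V.quadraticTwist (((-2 : ℤ)) : ℚ)).IsElliptic := by rw [Int.cast_neg, Int.cast_ofNat]; infer_instance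
    have hrest := frame_core_fixing_of_model hmod hnew hFH hrank (ds := -2) (Or.inr (Or.inr rfl)) hd4 hsq V C₁ hC₁ hfV W
      hC' hr
    obtain ⟨K, _, _, _, hK, h2, hsplit, 𝔭, 𝔭', h𝔭, h𝔭', h𝔭𝔭', hrest⟩ := hrest
    obtain ⟨κ, hκ, hκ2, hdK, V', _, _, hordV, hordV', hap, hgoodV, hrest⟩ := hrest
    obtain ⟨N', _, f', hfV', hV', hrest⟩ := hrest
    obtain ⟨M, M', _, _, g, g', W', _, hg, hg', hgε, hg'ε, hL', hL0, hrest⟩ := hrest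
    obtain ⟨H, _, _, _, _, hKH, t, htK, ht2, G, χ, hrest⟩ := hrest
    obtain ⟨s, hs, hGK, τ, hτG, hsτ, hτK, hτt, u, e, hu, hue, c, hcu, htors⟩ := hrest
    have hgε' : ∀ m : ℕ, cuspCoeff g m = (ZMod.χ₈'.ringHomComp (Int.castRingHom ℂ)) m * cuspCoeff f m := fun m => by
      rw [hgε m, chi8'_ringHomComp_natCast]
    have hg'ε' : ∀ m : ℕ, cuspCoeff g' m = (ZMod.χ₈'.ringHomComp (Int.castRingHom ℂ)) m * cuspCoeff f' m := fun m => by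
      rw [hg'ε m, chi8'_ringHomComp_natCast]
    have ht2' : t ^ 2 = algebraMap ℚ H (-2) := by exact_mod_cast ht2
    have htors' : ∀ Q : ((V.quadraticTwist (-2)).quadraticTwist e).toAffine.Point, IsOfFinAddOrder Q := by
      rw [← Int.cast_ofNat, ← Int.cast_neg]; exact htors
    have h0 := hasSum_padicLFunctionMinusBranch_neg_two_zero_of_member hmod V W hordV hfV hg hgε' hL0
    have hpair := exists_isMazurTateSigmaSqPair_two_of_smul_eq_cm7_quadraticTwist hd4 hsq V C₁ hC₁
    have hj : V.j = -3375 := j_eq_of_cm7_quadraticTwist hd4 V C₁ hC₁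
    have hgood : V.HasGoodReductionAtPrime 2 := cm7_quadraticTwist_hasGoodReductionAtPrime_two hd4 V C₁ hC₁
    have hΔ : V.Δ < 0 :=
      Δ_neg_of_smul_eq_quadraticTwist cm7 V (by rw [Δ_cm7]; norm_num) (d := ((d' : ℤ) : ℚ))
        (by exact_mod_cast (show (d' : ℤ) ≠ 0 by omega)) (C := C₁⁻¹) (by rw [← hC₁, inv_smul_smul])
    obtain ⟨DH, hDH, hGZc, r, hr0, hrv, hpinall⟩ := hdis8' ι K hK hsplit 𝔭 𝔭' h𝔭 h𝔭' h𝔭𝔭' κ hκ V V' hordV hpair f f'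
      hfV hfV' hV' g g' W W' hg hg' hgε' hg'ε' hr hL' hKH (exists_isCanonicalCyc_two_of_pair V H hpair) htK ht2'
      (not_mem_range_rat_of_not_mem_range htK) G χ s hs hGK τ hτG hsτ hτK hτt
    have hpin := hpinall Dc hDc P
    have hcan : Dc.pairing P P ≠ 0 :=
      bertrand_pairingSqMinusTwist_self_ne_zero_two.pairing_self_ne_zero hB hj hgood (d := -2) (by norm_num) hDc hP
    have hr0' : (r : ℚ_[2]) ≠ 0 := by exact_mod_cast hr0
    have hh₂ : (r : ℚ_[2]) * Dc.pairing P P ≠ 0 := mul_ne_zero hr0' hcan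
    obtain ⟨-, q, hq, -, hv⟩ := defectKey_chi8'_modulo_descent_min_of_Δ_neg ι K hGZ73 h2 hsplit 𝔭 𝔭' h𝔭 h𝔭' κ hκ
      hκ2 hdK V V' hΔ hordV hordV' hap hfV hfV' hV' h0 hmod W W' hg hg' hgε' hg'ε' hr hrk hL' hKH htK ht2' G χ s hs τ
      hτG hsτ hτK hτt hu hue c hcu hC hgen htors' DH hDH hpin hGZc hμ0 hμ hh₂
    have hval : ((r : ℚ_[2]) * Dc.pairing P P).valuation = ρ₈' + (Dc.pairing P P).valuation := by
      rw [Padic.valuation_mul hr0' hcan, Padic.valuation_ratCast, hrv]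
    rw [hval] at hv
    -- `BSD(W,2)` for the member `49a1^{(−2d′)}`
    obtain ⟨-, -, q', hq', hv'⟩ := hbsd (-2 * d') (by omega)
      (Squarefree.squarefree_of_dvd ⟨-1, by ring⟩ (squarefree_two_mul_of_emod_four hd4 hsq))
      (fun h => h7 (by omega)) (by omega) W _ (member_smul_eq_cm7_quadraticTwist hC₁ (-2) hC') hr
    have hqq : q' = q := by
      have h : ((q' : ℚ) : ℂ) = ((q : ℚ) : ℂ) := by rw [← hq', hq]
      exact_mod_cast h
    rw [hqq] at hv'
    show _ = _ + ((if (0 : ℤ) = 1 then ρ₄ else if (-d') % 8 % 4 = 1 then ρ₈ else ρ₈') - 2)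
    rw [if_neg (by norm_num), if_neg (by omega)]
    linarith

/-! ### §2 (Δ1) from the crux itself -/

/-- ★ **(Δ1) from THE CRUX `PrintCf2.SplitBadTwoRankOneOfFacts`**, granted its bundle `𝔅_split` (so that the crux yields `BSD(W,2)` for the
members), four S0′ prints and GZ86 I.(7.3): a `7`-free member `C • W = 49a1^{(d)}` (`d` squarefree, `d ≢ 1 (4)`) has CM with `2` split
(`j = −3375`) and is bad at `2`, so the crux applies; then `lawDescent_two_of_bsdp_sevenFree`. With the law socket
(`splitBadTwoRankOneOfFacts_of_printStubs_of_lawDescent_two`) this certifies: (Δ1) ⟺ the crux modulo the 12 named prints and `𝔅_split`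
(the line's research stub is not a strengthening of the crux). [cite: Disegni2017, Thm B] [cite: Miller2011LMS, Def. 1.1]
[cite: SilvermanAEC2009, X.5 Cor. 5.4.1 and VII.1 Prop. 1.3(b)] -/
theorem lawDescent_two_of_splitBadTwoRankOneOfFacts
    (hThmB : Disegni2017.thmB_chi_quadraticBaseChange)
    (hB : bertrand_pairingSqMinusTwist_self_ne_zero_two)
    (hFH : friedbergHoffstein_exists_heegnerField_split_twist_ne_zero)
    (hnp : ModularForms.nonempty_modularParametrizationData)
    (hGZ73 : GrossZagier1986_thm_I_7_3)
    (h𝔅 : rank_eq_analyticRank_of_analyticRank_le_one ∧ WeierstrassCurve.hasEntireLFunction_rat ∧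
      WeierstrassCurve.bsdRHS_eq_of_isIsogenous ∧ bsdTriple_of_hasCM_of_L_one_ne_zero ∧ KrizLi2019.thm112_bsdTwo_twist)
    (hcrux : Summit.BirchSwinnertonDyer.BirchSwinnertonDyer.Theses.PrintCf2.SplitBadTwoRankOneOfFacts) :
    ∃ e_D : ℤ → ℤ → ℤ,
    (∀ (d' : ℤ), d' % 4 = 1 → Squarefree d' → ¬ (7 : ℤ) ∣ d' →
      ∀ (V : WeierstrassCurve ℚ) [V.IsElliptic] [V.IsGloballyMinimal] (C₁ : VariableChange ℚ),
        C₁ • V = cm7.quadraticTwist (d' : ℚ) →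
      ∀ {N : ℕ} [NeZero N] (f : CuspForm (Gamma0 N) 2), IsNewformOf V f →
      ∀ (ϖ : ℚ), ϖ ≠ 0 → (ϖ : ℝ) * V.realPeriodRat = plusPeriod f →
      ∀ (W : WeierstrassCurve ℚ) [W.IsElliptic] [W.IsGloballyMinimal] [(V.quadraticTwist 2).IsElliptic]
        (C : VariableChange ℚ), C • W = V.quadraticTwist 2 → W.analyticRank = 1 →
      ∀ (P : (V.quadraticTwist 2).toAffine.Point), ¬ IsOfFinAddOrder P →
        (∀ R : (V.quadraticTwist 2).toAffine.Point,
          ∃ (k : ℤ) (T : (V.quadraticTwist 2).toAffine.Point), IsOfFinAddOrder T ∧ R = k • P + T) →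
      ∀ (Dc : PAdicHeightData (V.quadraticTwist 2) 2), Dc.IsCanonicalSqMinusTwist →
        (∑' k : ℕ, PowerSeries.coeff k (padicLFunction f (unitRoot V 2 : ℚ_[2])) * (k : ℚ_[2]) *
            (-2) ^ (k - 1)).valuation + padicValRat 2 ϖ - (Dc.pairing P P).valuation =
          (padicValNat 2 (Nat.card (AddCommGroup.primaryComponent W.sha 2)) : ℤ) +
            (padicValNat 2 W.tamagawaProduct : ℤ) - 2 * (padicValNat 2 W.torsionOrder : ℤ) + e_D 0 (d' % 8)) ∧
    (∀ (d' : ℤ), d' % 4 = 1 → Squarefree d' → ¬ (7 : ℤ) ∣ d' →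
      ∀ (V : WeierstrassCurve ℚ) [V.IsElliptic] [V.IsGloballyMinimal] (C₁ : VariableChange ℚ),
        C₁ • V = cm7.quadraticTwist (d' : ℚ) →
      ∀ {N : ℕ} [NeZero N] (f : CuspForm (Gamma0 N) 2), IsNewformOf V f →
      ∀ (μ : ℚ), μ ≠ 0 → (μ : ℝ) * V.imaginaryPeriodRat = minusPeriod f →
      ∀ (W : WeierstrassCurve ℚ) [W.IsElliptic] [W.IsGloballyMinimal] [(V.quadraticTwist (-1)).IsElliptic]
        (C : VariableChange ℚ), C • W = V.quadraticTwist (-1) → W.analyticRank = 1 →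
      ∀ (P : (V.quadraticTwist (-1)).toAffine.Point), ¬ IsOfFinAddOrder P →
        (∀ R : (V.quadraticTwist (-1)).toAffine.Point,
          ∃ (k : ℤ) (T : (V.quadraticTwist (-1)).toAffine.Point), IsOfFinAddOrder T ∧ R = k • P + T) →
      ∀ (Dc : PAdicHeightData (V.quadraticTwist (-1)) 2), Dc.IsCanonicalSqMinusTwist →
        (PowerSeries.coeff 1 (padicLFunctionMinusBranch f (unitRoot V 2 : ℚ_[2]) 1)).valuation + padicValRat 2 μ - (Dc.pairing P P).valuation =
          (padicValNat 2 (Nat.card (AddCommGroup.primaryComponent W.sha 2)) : ℤ) +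
            (padicValNat 2 W.tamagawaProduct : ℤ) - 2 * (padicValNat 2 W.torsionOrder : ℤ) + e_D 1 ((-d') % 8)) ∧
    (∀ (d' : ℤ), d' % 4 = 1 → Squarefree d' → ¬ (7 : ℤ) ∣ d' →
      ∀ (V : WeierstrassCurve ℚ) [V.IsElliptic] [V.IsGloballyMinimal] (C₁ : VariableChange ℚ),
        C₁ • V = cm7.quadraticTwist (d' : ℚ) →
      ∀ {N : ℕ} [NeZero N] (f : CuspForm (Gamma0 N) 2), IsNewformOf V f →
      ∀ (μ : ℚ), μ ≠ 0 → (μ : ℝ) * V.imaginaryPeriodRat = minusPeriod f →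
      ∀ (W : WeierstrassCurve ℚ) [W.IsElliptic] [W.IsGloballyMinimal] [(V.quadraticTwist (-2)).IsElliptic]
        (C : VariableChange ℚ), C • W = V.quadraticTwist (-2) → W.analyticRank = 1 →
      ∀ (P : (V.quadraticTwist (-2)).toAffine.Point), ¬ IsOfFinAddOrder P →
        (∀ R : (V.quadraticTwist (-2)).toAffine.Point,
          ∃ (k : ℤ) (T : (V.quadraticTwist (-2)).toAffine.Point), IsOfFinAddOrder T ∧ R = k • P + T) →
      ∀ (Dc : PAdicHeightData (V.quadraticTwist (-2)) 2), Dc.IsCanonicalSqMinusTwist →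
        (∑' k : ℕ, PowerSeries.coeff k (padicLFunctionMinusBranch f (unitRoot V 2 : ℚ_[2]) 1) * (k : ℚ_[2]) *
            (-2) ^ (k - 1)).valuation + padicValRat 2 μ - (Dc.pairing P P).valuation =
          (padicValNat 2 (Nat.card (AddCommGroup.primaryComponent W.sha 2)) : ℤ) +
            (padicValNat 2 W.tamagawaProduct : ℤ) - 2 * (padicValNat 2 W.torsionOrder : ℤ) + e_D 0 ((-d') % 8)) :=
  lawDescent_two_of_bsdp_sevenFree hThmB hB hFH hnp hGZ73 h𝔅.1 fun _ hd0 hsq _ hd4 W _ _ _ hC hr =>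
    have hcm := hasCM_and_cmSplit_two_of_smul_eq_cm7_quadraticTwist hd0 W hC
    hcrux h𝔅 W hcm.1 hr hcm.2 (not_good_two_of_smul_eq_cm7_quadraticTwist hsq hd4 W hC)

end Summit.BirchSwinnertonDyer.BirchSwinnertonDyer.Theorems.PrintCf2.DisegniPairTwo

end
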